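import Summits.NavierStokesRegularity.NavierStokesRegularity.Theorems.ExtremiserTransienceNearExtremalTransienceExtremiserLiouvilleConstantSpeedKKTTailProfile
import HarnessLib

/-!
# Crux `ExtremiserTransience.NearExtremalTransience` (stmt-NavierStokesRegularity-21883), line `extremiser_liouville`,
# stub K1b — KKT tail condition with a RATE, and the annihilation of SLOW power tails

`--supports stmt-NavierStokesRegularity-21883` (helper).  Author: prover seat `ns-el-k1b` (g4).  Quantitative form of
`residue_tail_pairing_tendsto_zero` (`…ConstantSpeedKKTTail`).

* `residue_tail_pairing_le`: for the residue object and a `c`-horizontal solenoidal profile `Φ ∈ C_c^∞(ℝ³ ∖ B_{r₀})` there are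
  `A, B ≥ 0` with, for all `R ≥ 1` and `δ ≥ 0` such that `‖v(x) − c‖ ≤ δ` on `‖x‖ ≥ r₀R`:
  **`|∫⟪curl v, curl φ_R⟫| ≤ A·δ + B/√R`** (`φ_R = Φ(·/R)`; the choice `η = R^{-1/2}` in the Young splitting of `c₁`).
* `residue_slowTailProfile_pairing_eq_zero`: if moreover `‖v(x) − c‖ ≤ C₀(1+‖x‖)^{-a}` with **`0 < a < 3/2`** and the
  rescaled vorticity `R^{1+a}·(curl v)(R y) → Ω(y)` uniformly on `tsupport(curl Φ)` (`Ω` continuous), then **`∫⟪Ω, curl Φ⟫ = 0`**.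
  Since `∫⟪curl v, curl φ_R⟫ = R^{1-a}∫⟪R^{1+a}(curl v)(R y), (curl Φ)(y)⟫dy`, for `a < 1` the pairing would DIVERGE like
  `R^{1-a}` unless the limit profile is annihilated — so the slow tails (down to the `|x|^{-1/2-}` permitted by `DV ∈ L²`), which
  the decay-gap Liouville cannot touch, are constrained exactly like the `|x|⁻¹` tail: every power-law tail profile of the residue,
  of any order `a < 3/2`, is weakly curl-free against `c`-horizontal solenoidal fields (`a > 1` is already impossible by
  `…ConstantSpeedDecayLiouville`).

WHAT THIS IS NOT: K1b is NOT proved; nothing here proves NS regularity. [folklore]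
-/

noncomputable section

open Set Filter Topology MeasureTheory Metric Function
open scoped ENNReal NNReal Topology InnerProductSpace RealInnerProductSpace ContDiff
open Literature.Analysis.FluidPDE Literature.Analysis

namespace Summit.NavierStokesRegularity.NavierStokesRegularity.Theorems

-- the problem directory repeats the summit name (`NavierStokesRegularity/NavierStokesRegularity`)
set_option linter.dupNamespace false

namespace ExtremiserLiouville

variable {v Φ : EuclideanSpace ℝ (Fin 3) → EuclideanSpace ℝ (Fin 3)} {c : EuclideanSpace ℝ (Fin 3)}

/-- **KKT tail condition with a rate**: `|a₁(φ_R)| ≤ A·δ + B/√R` whenever `‖v − c‖ ≤ δ` on `‖x‖ ≥ r₀R` (`R ≥ 1`). [folklore] -/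
theorem residue_tail_pairing_le {Φ : EuclideanSpace ℝ (Fin 3) → EuclideanSpace ℝ (Fin 3)}
    (hv : ContDiff ℝ ∞ v) (hdiv : VectorCalculus.IsDivFree v) {M B : ℝ} (hMpos : 0 < M)
    (hM : ∀ x, ‖v x‖ = M) (hB : ∀ x, ‖fderiv ℝ v x‖ ≤ B)
    (h1 : ∫⁻ x, ‖iteratedFDeriv ℝ 1 v x‖ₑ ^ 2 < ⊤) (h2 : ∫⁻ x, ‖iteratedFDeriv ℝ 2 v x‖ₑ ^ 2 < ⊤)
    (hpos : 0 < M * Real.sqrt (∫ x, ‖curl v x‖ ^ 2) * Real.sqrt (∫ x, frobeniusNormSq (fderiv ℝ (curl v) x)))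
    (hatt : |∫ x, ⟪curl v x, fderiv ℝ v x (curl v x)⟫| = (sInf {κ : ℝ | (∀ (v : EuclideanSpace ℝ (Fin 3) → EuclideanSpace ℝ (Fin 3)) (M B : ℝ), ContDiff ℝ (⊤ : ℕ∞) v → Literature.Analysis.FluidPDE.VectorCalculus.IsDivFree v → (∀ x, ‖v x‖ ≤ M) → (∀ x, ‖fderiv ℝ v x‖ ≤ B) → (∫⁻ x, ‖iteratedFDeriv ℝ 0 v x‖ₑ ^ 2 < ⊤) → (∫⁻ x, ‖iteratedFDeriv ℝ 1 v x‖ₑ ^ 2 < ⊤) → (∫⁻ x, ‖iteratedFDeriv ℝ 2 v x‖ₑ ^ 2 < ⊤) → |∫ x, ⟪Literature.Analysis.FluidPDE.curl v x, fderiv ℝ v x (Literature.Analysis.FluidPDE.curl v x)⟫_ℝ| ≤ κ * M * Real.sqrt (∫ x, ‖Literature.Analysis.FluidPDE.curl v x‖ ^ 2) * Real.sqrt (∫ x, Literature.Analysis.FluidPDE.frobeniusNormSq (fderiv ℝ (Literature.Analysis.FluidPDE.curl v) x)))}) * M * Real.sqrt (∫ x, ‖curl v x‖ ^ 2) * Real.sqrt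 (∫ x, frobeniusNormSq (fderiv ℝ (curl v) x)))
    (hΦ : ContDiff ℝ ∞ Φ) (hΦc : HasCompactSupport Φ) (hΦdiv : VectorCalculus.IsDivFree Φ) {r₀ : ℝ}
    (hΦ0 : ∀ y, ‖y‖ < r₀ → Φ y = 0) (hcΦ : ∀ y, ⟪c, Φ y⟫ = 0) :
    ∃ A B : ℝ, 0 ≤ A ∧ 0 ≤ B ∧ ∀ R : ℝ, 1 ≤ R → ∀ δ : ℝ, 0 ≤ δ →
      (∀ x, r₀ * R ≤ ‖x‖ → ‖v x - c‖ ≤ δ) →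
        |∫ x, ⟪curl v x, curl (fun y => Φ (R⁻¹ • y)) x⟫| ≤ A * δ + B / Real.sqrt R := by
  set K : ℝ := (sInf {κ : ℝ | (∀ (v : EuclideanSpace ℝ (Fin 3) → EuclideanSpace ℝ (Fin 3)) (M B : ℝ), ContDiff ℝ (⊤ : ℕ∞) v → Literature.Analysis.FluidPDE.VectorCalculus.IsDivFree v → (∀ x, ‖v x‖ ≤ M) → (∀ x, ‖fderiv ℝ v x‖ ≤ B) → (∫⁻ x, ‖iteratedFDeriv ℝ 0 v x‖ₑ ^ 2 < ⊤) → (∫⁻ x, ‖iteratedFDeriv ℝ 1 v x‖ₑ ^ 2 < ⊤) → (∫⁻ x, ‖iteratedFDeriv ℝ 2 v x‖ₑ ^ 2 < ⊤) → |∫ x, ⟪Literature.Analysis.FluidPDE.curl v x, fderiv ℝ v x (Literature.Analysis.FluidPDE.curl v x)⟫_ℝ| ≤ κ * M * Real.sqrt (∫ x, ‖Literature.Analysis.FluidPDE.curl v x‖ ^ 2) * Real.sqrt (∫ x, Literature.Analysis.FluidPDE.frobeniusNormSq (fderiv ℝ (Literature.Analysis.FluidPDE.curl v) x)))}) with hK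
  set Z : ℝ := ∫ x, ‖curl v x‖ ^ 2 with hZ
  set W : ℝ := ∫ x, frobeniusNormSq (fderiv ℝ (curl v) x) with hW
  set S : ℝ := ∫ x, ⟪curl v x, fderiv ℝ v x (curl v x)⟫ with hS
  have hKpos : 0 < K := lt_trans (by norm_num) DepletionLadder.sharpDepletion_gt
  have hZ0 : 0 ≤ Z := integral_nonneg fun x => sq_nonneg _
  have hW0 : 0 ≤ W := integral_nonneg fun x => frobeniusNormSq_nonneg _
  -- `Z, W > 0` and integrability of the densities (from `hpos`: a Bochner integral of a non-integrable function is `0`)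
  have hZpos : 0 < Z := by
    by_contra h
    have hZe : Z = 0 := le_antisymm (not_lt.1 h) hZ0
    rw [hZe, Real.sqrt_zero, mul_zero, zero_mul] at hpos
    exact lt_irrefl _ hpos
  have hWpos : 0 < W := by
    by_contra h
    have hWe : W = 0 := le_antisymm (not_lt.1 h) hW0
    rw [hWe, Real.sqrt_zero, mul_zero] at hpos
    exact lt_irrefl _ hpos
  have IZ : Integrable (fun x => ‖curl v x‖ ^ 2) volume := by
    by_contra h; exact hZpos.ne' (integral_undef h)
  have IW : Integrable (fun x => frobeniusNormSq (fderiv ℝ (curl v) x)) volume := by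
    by_contra h; exact hWpos.ne' (integral_undef h)
  have ID : Integrable (fun x => ‖fderiv ℝ v x‖ ^ 2) volume := by
    have h1' : ∫⁻ x, ‖fderiv ℝ v x‖ₑ ^ 2 < ⊤ := by
      refine lt_of_le_of_lt (le_of_eq (lintegral_congr fun x => ?_)) h1
      rw [← ofReal_norm, ← ofReal_norm, norm_iteratedFDeriv_one]
    exact integrable_sq_norm_of_lintegral_lt_top (hv.continuous_fderiv (by simp)) h1'
  -- profile constants
  obtain ⟨CΦ, hC0, hΦb, hcurlb, hDb, hDcurlb⟩ := exists_bounds_of_profile (hΦ.of_le (by norm_cast)) hΦc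
  have hDcurlc : HasCompactSupport (fderiv ℝ (curl Φ)) := by
    have hD : HasCompactSupport (fderiv ℝ Φ) := hΦc.fderiv (𝕜 := ℝ)
    have hcurl : HasCompactSupport (curl Φ) := by
      rw [curl_eq_curlCLM_comp]; exact hD.comp_left (map_zero _)
    exact hcurl.fderiv (𝕜 := ℝ)
  obtain ⟨r, hr⟩ := (Metric.isBounded_iff_subset_closedBall (0 : EuclideanSpace ℝ (Fin 3))).1 hDcurlc.isBounded
  set r₁ : ℝ := max r 1 with hr₁
  have hr₁pos : 0 < r₁ := lt_of_lt_of_le one_pos (le_max_right _ _)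
  have hsupp : tsupport (fderiv ℝ (curl Φ)) ⊆ closedBall 0 r₁ := hr.trans (closedBall_subset_closedBall (le_max_left _ _))
  set v₁ : ℝ := (volume (ball (0 : EuclideanSpace ℝ (Fin 3)) 1)).toReal with hv₁
  have hv₁0 : 0 ≤ v₁ := ENNReal.toReal_nonneg
  -- the majorant of the `J₁` density
  set g : EuclideanSpace ℝ (Fin 3) → ℝ := fun x => CΦ * (‖fderiv ℝ v x‖ ^ 2 + 2 * ‖curl v x‖ ^ 2) with hg
  have hgi : Integrable g volume := (ID.add (IZ.const_mul 2)).const_mul CΦ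
  set G : ℝ := ∫ x, g x with hG
  have hG0 : 0 ≤ G := integral_nonneg fun x => by positivity
  have hΦd : Differentiable ℝ Φ := hΦ.differentiable (by simp)
  have hΦ2 : ContDiff ℝ 2 Φ := hΦ.of_le (by norm_cast)
  -- the constants
  set D₀ : ℝ := K ^ 2 * M ^ 2 * W with hD₀def
  have hD₀ : 0 < D₀ := by positivity
  set Bn : ℝ := |S| * G + K ^ 2 * M ^ 2 * Z * (W / 2 + 3 * CΦ ^ 2 * r₁ ^ 3 * v₁ / 2) with hBn
  have hBn0 : 0 ≤ Bn := by positivity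
  refine ⟨K ^ 2 * Z * W * CΦ / D₀, Bn / D₀, by positivity, by positivity, fun R hR1 δ hδ0 hδ => ?_⟩
  have hRpos : 0 < R := lt_of_lt_of_le one_pos hR1
  have hRinv : 0 < R⁻¹ := inv_pos.2 hRpos
  have hsR : 0 < Real.sqrt R := Real.sqrt_pos.2 hRpos
  set η : ℝ := (Real.sqrt R)⁻¹ with hηdef
  have hη : 0 < η := inv_pos.2 hsR
  -- the test field `φ_R`
  set φ : EuclideanSpace ℝ (Fin 3) → EuclideanSpace ℝ (Fin 3) := fun y => Φ (R⁻¹ • y) with hφdef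
  have hφ : ContDiff ℝ ∞ φ := contDiff_rescale hΦ R
  have hφc : HasCompactSupport φ := hasCompactSupport_rescale hΦc hRpos.ne'
  have hφdiv : VectorCalculus.IsDivFree φ := isDivFree_rescale hΦd hΦdiv R
  -- the slope `s = δ CΦ`
  have hs : ∀ x, |⟪v x, φ x⟫| ≤ δ * CΦ := by
    intro x
    by_cases hx : ‖R⁻¹ • x‖ < r₀
    · have : φ x = 0 := hΦ0 _ hx
      rw [this, inner_zero_right, abs_zero]; exact mul_nonneg hδ0 hC0
    · have hxn : r₀ * R ≤ ‖x‖ := by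
        rw [not_lt, norm_smul, Real.norm_eq_abs, abs_of_pos hRinv] at hx
        have := mul_le_mul_of_nonneg_left hx hRpos.le
        rw [← mul_assoc, mul_inv_cancel₀ hRpos.ne', one_mul] at this
        linarith [this]
      have e : ⟪v x, φ x⟫ = ⟪v x - c, φ x⟫ := by
        rw [inner_sub_left, hφdef]; simp only; rw [hcΦ, sub_zero]
      rw [e]
      exact (abs_real_inner_le_norm _ _).trans (mul_le_mul (hδ x hxn) (hΦb _) (norm_nonneg _) hδ0)
  -- two-sided KKT, folded into the local names
  have hkkt := kkt_twoSided hv hdiv hMpos hM hB h1 h2 hatt hφ hφc hφdiv hs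
  rw [← hK, ← hZ, ← hW, ← hS, ← hD₀def] at hkkt
  set Aφ : ℝ := ∫ x, ⟪curl v x, curl φ x⟫ with hAφ
  set Jφ : ℝ := ∫ x, (⟪curl φ x, fderiv ℝ v x (curl v x)⟫ + ⟪curl v x, fderiv ℝ φ x (curl v x)⟫ +
      ⟪curl v x, fderiv ℝ v x (curl φ x)⟫) with hJφ
  set Cφ : ℝ := ∫ x, ∑ i, ⟪fderiv ℝ (curl v) x (EuclideanSpace.basisFun (Fin 3) ℝ i),
      fderiv ℝ (curl φ) x (EuclideanSpace.basisFun (Fin 3) ℝ i)⟫ with hCφ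
  -- bound on `J₁(φ_R)`
  have hJ : |Jφ| ≤ G / R := by
    rw [hJφ]
    have hptw : ∀ x, |⟪curl φ x, fderiv ℝ v x (curl v x)⟫ + ⟪curl v x, fderiv ℝ φ x (curl v x)⟫ +
        ⟪curl v x, fderiv ℝ v x (curl φ x)⟫| ≤ g x / R := by
      intro x
      have hcφ : ‖curl φ x‖ ≤ R⁻¹ * CΦ := by
        rw [hφdef, curl_rescale hΦd, norm_smul, Real.norm_eq_abs, abs_of_pos hRinv]
        exact mul_le_mul_of_nonneg_left (hcurlb _) hRinv.le
      have hDφ : ‖fderiv ℝ φ x‖ ≤ R⁻¹ * CΦ := by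
        rw [hφdef, fderiv_rescale hΦd, norm_smul, Real.norm_eq_abs, abs_of_pos hRinv]
        exact mul_le_mul_of_nonneg_left (hDb _) hRinv.le
      set a := ‖fderiv ℝ v x‖ with ha_def
      set b := ‖curl v x‖ with hb_def
      have ha : 0 ≤ a := norm_nonneg _
      have hb : 0 ≤ b := norm_nonneg _
      have t1 : |⟪curl φ x, fderiv ℝ v x (curl v x)⟫| ≤ R⁻¹ * CΦ * (a * b) := by
        refine (abs_real_inner_le_norm _ _).trans ?_
        calc ‖curl φ x‖ * ‖fderiv ℝ v x (curl v x)‖ ≤ (R⁻¹ * CΦ) * (a * b) :=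
              mul_le_mul hcφ ((fderiv ℝ v x).le_opNorm _) (norm_nonneg _) (by positivity)
          _ = R⁻¹ * CΦ * (a * b) := rfl
      have t2 : |⟪curl v x, fderiv ℝ φ x (curl v x)⟫| ≤ R⁻¹ * CΦ * (b * b) := by
        refine (abs_real_inner_le_norm _ _).trans ?_
        calc ‖curl v x‖ * ‖fderiv ℝ φ x (curl v x)‖ ≤ b * ((R⁻¹ * CΦ) * b) :=
              mul_le_mul_of_nonneg_left (((fderiv ℝ φ x).le_opNorm _).trans (mul_le_mul_of_nonneg_right hDφ hb)) hb
          _ = R⁻¹ * CΦ * (b * b) := by ring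
      have t3 : |⟪curl v x, fderiv ℝ v x (curl φ x)⟫| ≤ R⁻¹ * CΦ * (a * b) := by
        refine (abs_real_inner_le_norm _ _).trans ?_
        calc ‖curl v x‖ * ‖fderiv ℝ v x (curl φ x)‖ ≤ b * (a * (R⁻¹ * CΦ)) :=
              mul_le_mul_of_nonneg_left (((fderiv ℝ v x).le_opNorm _).trans (mul_le_mul_of_nonneg_left hcφ ha)) hb
          _ = R⁻¹ * CΦ * (a * b) := by ring
      have hsum := (abs_add_le _ _).trans (add_le_add ((abs_add_le _ _).trans (add_le_add t1 t2)) t3)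
      have hab : 2 * (a * b) + b ^ 2 ≤ a ^ 2 + 2 * b ^ 2 := by
        have := two_mul_le_add_sq a b
        linarith only [this]
      calc |⟪curl φ x, fderiv ℝ v x (curl v x)⟫ + ⟪curl v x, fderiv ℝ φ x (curl v x)⟫ + ⟪curl v x, fderiv ℝ v x (curl φ x)⟫|
          ≤ R⁻¹ * CΦ * (a * b) + R⁻¹ * CΦ * (b * b) + R⁻¹ * CΦ * (a * b) := hsum
        _ = R⁻¹ * CΦ * (2 * (a * b) + b ^ 2) := by ring
        _ ≤ R⁻¹ * CΦ * (a ^ 2 + 2 * b ^ 2) := mul_le_mul_of_nonneg_left hab (mul_nonneg hRinv.le hC0)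
        _ = g x / R := by rw [hg, ha_def, hb_def, div_eq_inv_mul]; ring
    refine (abs_integral_le_integral_abs).trans ?_
    have hgi' : Integrable (fun x => g x / R) volume := hgi.div_const R
    calc (∫ x, |⟪curl φ x, fderiv ℝ v x (curl v x)⟫ + ⟪curl v x, fderiv ℝ φ x (curl v x)⟫ + ⟪curl v x, fderiv ℝ v x (curl φ x)⟫|)
        ≤ ∫ x, g x / R := integral_mono_of_nonneg (Eventually.of_forall fun x => abs_nonneg _) hgi'
            (Eventually.of_forall hptw)
      _ = G / R := by rw [integral_div]
  -- bound on `c₁(φ_R)`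
  have hCb : |Cφ| ≤ η / 2 * W + 3 * CΦ ^ 2 * r₁ ^ 3 * v₁ / (2 * η) / R := by
    rw [hCφ]
    set ind : EuclideanSpace ℝ (Fin 3) → ℝ := (closedBall (0 : EuclideanSpace ℝ (Fin 3)) (R * r₁)).indicator fun _ => (1 : ℝ)
      with hind
    have hptw : ∀ x, |∑ i, ⟪fderiv ℝ (curl v) x (EuclideanSpace.basisFun (Fin 3) ℝ i),
        fderiv ℝ (curl φ) x (EuclideanSpace.basisFun (Fin 3) ℝ i)⟫| ≤
        η / 2 * frobeniusNormSq (fderiv ℝ (curl v) x) + 1 / (2 * η) * (3 * (R⁻¹ * (R⁻¹ * CΦ)) ^ 2 * ind x) := by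
      intro x
      have hη' : 0 ≤ 1 / (2 * η) := by rw [one_div]; exact (inv_pos.2 (by linarith only [hη])).le
      refine (sum_inner_le_frobeniusNormSq (fderiv ℝ (curl v) x) (fderiv ℝ (curl φ) x) hη).trans
        (add_le_add le_rfl (mul_le_mul_of_nonneg_left ?_ hη'))
      refine (BradshawTsai2017.frobeniusNormSq_le_three_mul_norm_sq _).trans ?_
      rw [hφdef, fderiv_curl_rescale hΦ2, norm_smul, norm_smul, Real.norm_eq_abs, abs_of_pos hRinv]
      by_cases hx : x ∈ closedBall (0 : EuclideanSpace ℝ (Fin 3)) (R * r₁)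
      · rw [hind, indicator_of_mem hx, mul_one]
        have h0 : 0 ≤ R⁻¹ * (R⁻¹ * ‖fderiv ℝ (curl Φ) (R⁻¹ • x)‖) :=
          mul_nonneg hRinv.le (mul_nonneg hRinv.le (norm_nonneg _))
        have : R⁻¹ * (R⁻¹ * ‖fderiv ℝ (curl Φ) (R⁻¹ • x)‖) ≤ R⁻¹ * (R⁻¹ * CΦ) :=
          mul_le_mul_of_nonneg_left (mul_le_mul_of_nonneg_left (hDcurlb _) hRinv.le) hRinv.le
        exact mul_le_mul_of_nonneg_left (pow_le_pow_left₀ h0 this 2) (by norm_num)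
      · have hy : R⁻¹ • x ∉ tsupport (fderiv ℝ (curl Φ)) := by
          intro hmem
          have := hsupp hmem
          rw [mem_closedBall, dist_zero_right, norm_smul, Real.norm_eq_abs, abs_of_pos hRinv] at this
          apply hx
          rw [mem_closedBall, dist_zero_right]
          have := mul_le_mul_of_nonneg_left this hRpos.le
          rwa [← mul_assoc, mul_inv_cancel₀ hRpos.ne', one_mul] at this
        have hind0 : ind x = 0 := by rw [hind, indicator_of_notMem hx]
        rw [image_eq_zero_of_notMem_tsupport hy, norm_zero, mul_zero, mul_zero, hind0, mul_zero]
        norm_num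
    have hvol : (volume (closedBall (0 : EuclideanSpace ℝ (Fin 3)) (R * r₁))).toReal = (R * r₁) ^ 3 * v₁ := by
      rw [Measure.addHaar_closedBall volume (0 : EuclideanSpace ℝ (Fin 3)) (by positivity : (0 : ℝ) ≤ R * r₁),
        finrank_euclideanSpace, Fintype.card_fin, ENNReal.toReal_mul, ENNReal.toReal_ofReal (by positivity)]
    have hind_int : Integrable ind volume := by
      rw [hind, integrable_indicator_iff measurableSet_closedBall]
      exact integrableOn_const measure_closedBall_lt_top.ne
    have hmaj_int : Integrable (fun x => η / 2 * frobeniusNormSq (fderiv ℝ (curl v) x) +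
        1 / (2 * η) * (3 * (R⁻¹ * (R⁻¹ * CΦ)) ^ 2 * ind x)) volume :=
      (IW.const_mul _).add ((hind_int.const_mul _).const_mul _)
    refine (abs_integral_le_integral_abs).trans ((integral_mono_of_nonneg (Eventually.of_forall fun x => abs_nonneg _)
      hmaj_int (Eventually.of_forall hptw)).trans (le_of_eq ?_))
    rw [integral_add (IW.const_mul _) ((hind_int.const_mul _).const_mul _), integral_const_mul, integral_const_mul,
      integral_const_mul, hind, integral_indicator measurableSet_closedBall, setIntegral_const, smul_eq_mul, mul_one,
      Measure.real, hvol, ← hW]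
    field_simp
  -- assemble
  have hJterm : |S| * |Jφ| ≤ |S| * G / R := by
    have := mul_le_mul_of_nonneg_left hJ (abs_nonneg S)
    have e : |S| * (G / R) = |S| * G / R := by ring
    linarith only [this, e]
  have hKMZ : 0 ≤ K ^ 2 * M ^ 2 * Z := by positivity
  have hCterm : K ^ 2 * M ^ 2 * Z * |Cφ| ≤
      K ^ 2 * M ^ 2 * Z * (η / 2 * W) + K ^ 2 * M ^ 2 * Z * (3 * CΦ ^ 2 * r₁ ^ 3 * v₁ / (2 * η)) / R := by
    have := mul_le_mul_of_nonneg_left hCb hKMZ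
    have e : K ^ 2 * M ^ 2 * Z * (η / 2 * W + 3 * CΦ ^ 2 * r₁ ^ 3 * v₁ / (2 * η) / R) =
        K ^ 2 * M ^ 2 * Z * (η / 2 * W) + K ^ 2 * M ^ 2 * Z * (3 * CΦ ^ 2 * r₁ ^ 3 * v₁ / (2 * η)) / R := by ring
    linarith only [this, e]
  -- finish: `η = 1/√R`, `1/R ≤ 1/√R`
  have hsq : Real.sqrt R * Real.sqrt R = R := Real.mul_self_sqrt hRpos.le
  have hsR1 : 1 ≤ Real.sqrt R := by rw [← Real.sqrt_one]; exact Real.sqrt_le_sqrt hR1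
  have hinvR : 1 / R ≤ 1 / Real.sqrt R := by
    rw [div_le_div_iff₀ hRpos hsR]; nlinarith only [hsR1, hsq, hsR]
  have hJ' : |S| * G / R ≤ |S| * G / Real.sqrt R := by
    have := mul_le_mul_of_nonneg_left hinvR (mul_nonneg (abs_nonneg S) hG0)
    simpa only [mul_one_div] using this
  have hsd : Real.sqrt R / R = 1 / Real.sqrt R := Real.sqrt_div_self'
  have h1' : η / 2 * W = W / 2 * (1 / Real.sqrt R) := by rw [hηdef, one_div]; ring
  have h2' : K ^ 2 * M ^ 2 * Z * (3 * CΦ ^ 2 * r₁ ^ 3 * v₁ / (2 * η)) / R =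
      K ^ 2 * M ^ 2 * Z * (3 * CΦ ^ 2 * r₁ ^ 3 * v₁ / 2) * (1 / Real.sqrt R) := by
    rw [← hsd, hηdef]
    field_simp
  have hC' : K ^ 2 * M ^ 2 * Z * (η / 2 * W) + K ^ 2 * M ^ 2 * Z * (3 * CΦ ^ 2 * r₁ ^ 3 * v₁ / (2 * η)) / R =
      K ^ 2 * M ^ 2 * Z * (W / 2 + 3 * CΦ ^ 2 * r₁ ^ 3 * v₁ / 2) / Real.sqrt R := by
    rw [h2', h1']
    ring
  have hfin : D₀ * |Aφ| ≤ K ^ 2 * Z * W * CΦ * δ + Bn / Real.sqrt R := by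
    have e : Bn / Real.sqrt R = |S| * G / Real.sqrt R + K ^ 2 * M ^ 2 * Z * (W / 2 + 3 * CΦ ^ 2 * r₁ ^ 3 * v₁ / 2) / Real.sqrt R := by
      rw [hBn]; ring
    have e2 : K ^ 2 * Z * W * (δ * CΦ) = K ^ 2 * Z * W * CΦ * δ := by ring
    linarith only [hkkt, hJterm, hCterm, hJ', hC', e, e2]
  have : |Aφ| ≤ (K ^ 2 * Z * W * CΦ * δ + Bn / Real.sqrt R) / D₀ := by
    rw [le_div_iff₀ hD₀]; linarith only [hfin]
  calc |Aφ| ≤ (K ^ 2 * Z * W * CΦ * δ + Bn / Real.sqrt R) / D₀ := this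
    _ = K ^ 2 * Z * W * CΦ / D₀ * δ + Bn / D₀ / Real.sqrt R := by ring


/-- **SLOW power tails are annihilated too.**  If the residue object has `‖v(x) − c‖ ≤ C₀(1+‖x‖)^{-a}` for some
`0 < a < 3/2` and the rescaled vorticity `R^{1+a}·(curl v)(R y)` converges uniformly on `tsupport (curl Φ)` to a continuous `Ω`
(`Φ` a `c`-horizontal solenoidal profile vanishing on `B(0,r₀)`), then `∫⟪Ω, curl Φ⟫ = 0`.  (For `a > 1` the residue does not
exist at all, `…ConstantSpeedDecayLiouville`; the content is the range `a ≤ 1`, where `∫⟪curl v, curl φ_R⟫ = R^{1-a}·∫⟪R^{1+a}ω(R·),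
curl Φ⟫` would otherwise diverge.) [folklore] -/
theorem residue_slowTailProfile_pairing_eq_zero
    (hv : ContDiff ℝ ∞ v) (hdiv : VectorCalculus.IsDivFree v) {M B : ℝ} (hMpos : 0 < M)
    (hM : ∀ x, ‖v x‖ = M) (hB : ∀ x, ‖fderiv ℝ v x‖ ≤ B)
    (h1 : ∫⁻ x, ‖iteratedFDeriv ℝ 1 v x‖ₑ ^ 2 < ⊤) (h2 : ∫⁻ x, ‖iteratedFDeriv ℝ 2 v x‖ₑ ^ 2 < ⊤)
    (hpos : 0 < M * Real.sqrt (∫ x, ‖curl v x‖ ^ 2) * Real.sqrt (∫ x, frobeniusNormSq (fderiv ℝ (curl v) x)))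
    (hatt : |∫ x, ⟪curl v x, fderiv ℝ v x (curl v x)⟫| = (sInf {κ : ℝ | (∀ (v : EuclideanSpace ℝ (Fin 3) → EuclideanSpace ℝ (Fin 3)) (M B : ℝ), ContDiff ℝ (⊤ : ℕ∞) v → Literature.Analysis.FluidPDE.VectorCalculus.IsDivFree v → (∀ x, ‖v x‖ ≤ M) → (∀ x, ‖fderiv ℝ v x‖ ≤ B) → (∫⁻ x, ‖iteratedFDeriv ℝ 0 v x‖ₑ ^ 2 < ⊤) → (∫⁻ x, ‖iteratedFDeriv ℝ 1 v x‖ₑ ^ 2 < ⊤) → (∫⁻ x, ‖iteratedFDeriv ℝ 2 v x‖ₑ ^ 2 < ⊤) → |∫ x, ⟪Literature.Analysis.FluidPDE.curl v x, fderiv ℝ v x (Literature.Analysis.FluidPDE.curl v x)⟫_ℝ| ≤ κ * M * Real.sqrt (∫ x, ‖Literature.Analysis.FluidPDE.curl v x‖ ^ 2) * Real.sqrt (∫ x, Literature.Analysis.FluidPDE.frobeniusNormSq (fderiv ℝ (Literature.Analysis.FluidPDE.curl v) x)))}) * M * Real.sqrt (∫ x, ‖curl v x‖ ^ 2) * Real.sqrt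 (∫ x, frobeniusNormSq (fderiv ℝ (curl v) x)))
    (hΦ : ContDiff ℝ ∞ Φ) (hΦc : HasCompactSupport Φ) (hΦdiv : VectorCalculus.IsDivFree Φ) {r₀ : ℝ} (hr₀ : 0 < r₀)
    (hΦ0 : ∀ y, ‖y‖ < r₀ → Φ y = 0) (hcΦ : ∀ y, ⟪c, Φ y⟫ = 0)
    {a C₀ : ℝ} (ha0 : 0 < a) (ha : a < 3 / 2) (hC₀ : 0 ≤ C₀) (hdec : ∀ x, ‖v x - c‖ ≤ C₀ * (1 + ‖x‖) ^ (-a))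
    {Ω : EuclideanSpace ℝ (Fin 3) → EuclideanSpace ℝ (Fin 3)} (hΩ : Continuous Ω)
    (hconv : TendstoUniformlyOn (fun (R : ℝ) (y : EuclideanSpace ℝ (Fin 3)) => (R ^ (1 + a)) • curl v (R • y)) Ω atTop
      (tsupport (curl Φ))) :
    ∫ y, ⟪Ω y, curl Φ y⟫ = 0 := by
  obtain ⟨A, Bc, hA0, hB0, hrate⟩ :=
    residue_tail_pairing_le hv hdiv hMpos hM hB h1 h2 hpos hatt hΦ hΦc hΦdiv hΦ0 hcΦ
  have hΦd : Differentiable ℝ Φ := hΦ.differentiable (by simp)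
  have hcurlΦ : Continuous (curl Φ) := continuous_curl (hΦ.of_le (by norm_cast))
  have hcurlΦc : HasCompactSupport (curl Φ) := by
    rw [curl_eq_curlCLM_comp]; exact (hΦc.fderiv (𝕜 := ℝ)).comp_left (map_zero _)
  have hcv : Continuous (curl v) := continuous_curl (hv.of_le (by norm_cast))
  set T : ℝ → ℝ := fun R => ∫ y, ⟪(R ^ (1 + a)) • curl v (R • y), curl Φ y⟫ with hT
  -- (i) `T R → ∫⟪Ω, curl Φ⟫` (uniform convergence on the support)
  have hnorm_int : Integrable (fun y => ‖curl Φ y‖) volume :=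
    (hcurlΦ.norm).integrable_of_hasCompactSupport hcurlΦc.norm
  have hlim : Tendsto T atTop (𝓝 (∫ y, ⟪Ω y, curl Φ y⟫)) := by
    rw [Metric.tendsto_atTop]
    intro ε hε
    set I : ℝ := ∫ y, ‖curl Φ y‖ with hI
    have hI0 : 0 ≤ I := integral_nonneg fun y => norm_nonneg _
    have hη : 0 < ε / (2 * (I + 1)) := by positivity
    obtain ⟨N, hN⟩ := eventually_atTop.1 ((Metric.tendstoUniformlyOn_iff.1 hconv) _ hη)
    refine ⟨N, fun R hR => ?_⟩
    have hptw : ∀ y, ‖⟪(R ^ (1 + a)) • curl v (R • y), curl Φ y⟫ - ⟪Ω y, curl Φ y⟫‖ ≤ ε / (2 * (I + 1)) * ‖curl Φ y‖ := by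
      intro y
      rw [← inner_sub_left, Real.norm_eq_abs]
      by_cases hy : y ∈ tsupport (curl Φ)
      · have hd := hN R hR y hy
        rw [dist_eq_norm, ← norm_neg, neg_sub] at hd
        exact (abs_real_inner_le_norm _ _).trans (mul_le_mul_of_nonneg_right hd.le (norm_nonneg _))
      · rw [image_eq_zero_of_notMem_tsupport hy, inner_zero_right, abs_zero, norm_zero, mul_zero]
    have hi1 : Integrable (fun y => ⟪(R ^ (1 + a)) • curl v (R • y), curl Φ y⟫) volume := by
      refine Continuous.integrable_of_hasCompactSupport ?_ ?_
      · exact ((hcv.comp (continuous_const_smul R)).const_smul (R ^ (1 + a))).inner hcurlΦ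
      · exact hcurlΦc.mono fun y hy => by
          contrapose! hy; simp only [mem_support, not_not] at hy; simp [hy]
    have hi2 : Integrable (fun y => ⟪Ω y, curl Φ y⟫) volume := by
      refine Continuous.integrable_of_hasCompactSupport (hΩ.inner hcurlΦ) ?_
      exact hcurlΦc.mono fun y hy => by
        contrapose! hy; simp only [mem_support, not_not] at hy; simp [hy]
    rw [dist_eq_norm, hT]
    simp only
    rw [← integral_sub hi1 hi2]
    calc ‖∫ y, (⟪(R ^ (1 + a)) • curl v (R • y), curl Φ y⟫ - ⟪Ω y, curl Φ y⟫)‖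
        ≤ ∫ y, ε / (2 * (I + 1)) * ‖curl Φ y‖ :=
          norm_integral_le_of_norm_le (hnorm_int.const_mul _) (Eventually.of_forall hptw)
      _ = ε / (2 * (I + 1)) * I := by rw [integral_const_mul]
      _ < ε := by
          rw [div_mul_eq_mul_div, div_lt_iff₀ (by positivity)]
          nlinarith
  -- (ii) `T R → 0` from the rate: `|T R| = R^{a-1}|a₁(φ_R)| ≤ R^{a-1}(A C₀ (r₀R)^{-a} + Bc R^{-1/2})`
  have hzero : Tendsto T atTop (𝓝 0) := by
    have hbound : ∀ᶠ R : ℝ in atTop, ‖T R‖ ≤ A * C₀ * r₀ ^ (-a) * R ^ (-(1 : ℝ)) + Bc * R ^ (a - 3 / 2) := by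
      filter_upwards [eventually_ge_atTop (1 : ℝ)] with R hR1
      have hRpos : 0 < R := lt_of_lt_of_le one_pos hR1
      -- the tail bound on `‖x‖ ≥ r₀ R`
      have hδ : ∀ x : EuclideanSpace ℝ (Fin 3), r₀ * R ≤ ‖x‖ → ‖v x - c‖ ≤ C₀ * (r₀ * R) ^ (-a) := by
        intro x hx
        refine (hdec x).trans (mul_le_mul_of_nonneg_left ?_ hC₀)
        exact Real.rpow_le_rpow_of_nonpos (by positivity) (by linarith) (by linarith)
      have hr := hrate R hR1 (C₀ * (r₀ * R) ^ (-a)) (by positivity) hδ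
      -- `a₁(φ_R) = R^{1-a} · T R`
      have hscale : (∫ x, ⟪curl v x, curl (fun y => Φ (R⁻¹ • y)) x⟫) = R ^ (1 - a) * T R := by
        rw [integral_inner_curl_curl_rescale hΦd hRpos, hT]
        simp only
        rw [← integral_const_mul]
        refine integral_congr_ae (Eventually.of_forall fun y => ?_)
        simp only [inner_smul_left, RCLike.conj_to_real, ← mul_assoc]
        congr 1
        rw [← Real.rpow_natCast, ← Real.rpow_add hRpos]
        norm_num
      rw [hscale, abs_mul, abs_of_pos (Real.rpow_pos_of_pos hRpos _)] at hr
      have hRa : 0 < R ^ (1 - a) := Real.rpow_pos_of_pos hRpos _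
      rw [Real.norm_eq_abs]
      have hT' : |T R| ≤ (A * (C₀ * (r₀ * R) ^ (-a)) + Bc / Real.sqrt R) / R ^ (1 - a) := by
        rw [le_div_iff₀ hRa]; linarith [hr]
      refine hT'.trans (le_of_eq ?_)
      rw [Real.sqrt_eq_rpow, Real.mul_rpow hr₀.le hRpos.le, div_eq_mul_inv, ← Real.rpow_neg hRpos.le]
      have e1 : R ^ (-a) * R ^ (-(1 - a)) = R ^ (-(1 : ℝ)) := by
        rw [← Real.rpow_add hRpos]; congr 1; ring
      have e2 : (R ^ ((1 : ℝ) / 2))⁻¹ * R ^ (-(1 - a)) = R ^ (a - 3 / 2) := by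
        rw [← Real.rpow_neg hRpos.le, ← Real.rpow_add hRpos]; congr 1; ring
      calc (A * (C₀ * (r₀ ^ (-a) * R ^ (-a))) + Bc * (R ^ ((1 : ℝ) / 2))⁻¹) * R ^ (-(1 - a))
          = A * C₀ * r₀ ^ (-a) * (R ^ (-a) * R ^ (-(1 - a))) + Bc * ((R ^ ((1 : ℝ) / 2))⁻¹ * R ^ (-(1 - a))) := by ring
        _ = A * C₀ * r₀ ^ (-a) * R ^ (-(1 : ℝ)) + Bc * R ^ (a - 3 / 2) := by rw [e1, e2]
    refine squeeze_zero_norm' hbound ?_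
    have t1 : Tendsto (fun R : ℝ => R ^ (-(1 : ℝ))) atTop (𝓝 0) := tendsto_rpow_neg_atTop one_pos
    have t2 : Tendsto (fun R : ℝ => R ^ (a - 3 / 2)) atTop (𝓝 0) := by
      have : a - 3 / 2 = -(3 / 2 - a) := by ring
      rw [this]; exact tendsto_rpow_neg_atTop (by linarith)
    simpa using (t1.const_mul (A * C₀ * r₀ ^ (-a))).add (t2.const_mul Bc)
  exact tendsto_nhds_unique hlim hzero


end ExtremiserLiouville

end Summit.NavierStokesRegularity.NavierStokesRegularity.Theorems

end
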